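/-
HONEST FRAMING: certified error envelopes and provably optimal rounding/accumulation schemes for
low-precision formats under stated cost models; every table by two implementations; no hardware
or vendor claims.
-/
import Summits.Ventures.CertifiedArithmetic.LowPrec.OptDemotionBudgetCheck
import Summits.Ventures.CertifiedArithmetic.LowPrec.OptDemotionMonoW

/-!
# The demotion law (Theorem T8), part 7d: KERNEL CERTIFICATES of Conjecture D via `Φ*` at (q,p) = (4,2)

`decide +kernel` evaluations of `budgetCheck 4 2` (part 7c) and the resulting theorems
`s ≤ Q_t · fl_p(ŝ)` for ALL nonnegative `F(4, emin)` data and ANY nearest roundings into `F(4, emin)`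
and `F(2, emin)`:
* EVERY summation tree with at most 7 summands (`conjectureD_4_2_of_le_seven`; 197 ordered shapes);
* every tree of the shape of opt gen 11's 37-leaf GOOD-ACTIVE failure `opt37` (`conjectureD_opt37`) —
  a tree on which every earlier all-tree route (GOOD-ACTIVE, the Q-cap node step) broke.
With the every-tree witness `demotion_tree_witness` (part 4; ties-to-even, `q ≥ p+2`, `p ≥ 2`) these
are EXACT: `D_t = Q_t`.  Cost: ≈0.2 s of kernel time per internal node at `q = 4`; each `decide` is
kept well below a minute (blocks `chunk`, reassembled by `all_of_chunks` / `chunks_succ`).  Part 7d′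
(`OptDemotionBudgetCertQ5`) has `q = 5` and the 43-leaf `gaCex43`; part 7f eight summands.  The same
evaluator in exact rational arithmetic (`code/lean/demote_g11/phistar.py`, identical tables)
certifies `D* = Q` for all shapes `n ≤ 8` at `(4,2)` and for opt gen 12's 17 267-leaf tree `b*` of
C26/C27.
-/

namespace Summit.Ventures.CertifiedArithmetic.LowPrec.Opt

open Literature.ComputerArithmetic.JeannerodRump2018
open Literature.ComputerArithmetic.JeannerodRump2018.SumTree

/-! ## Kernel certificates (part 7d)

Each `decide +kernel` below evaluates the relaxation tables of a batch of shapes (well under a minute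
of kernel time per theorem); batches are cut with `chunk` and reassembled with `all_of_chunks`. -/

/-- The `i`-th block of length `k` of a list. -/
def chunk {α : Type} (l : List α) (k i : ℕ) : List α := (l.drop (k * i)).take k

/-- Reassembling a list from its first `n` blocks of length `k`. -/
theorem all_of_chunks {α : Type} (l : List α) (f : α → Bool) (k n : ℕ) (hk : 0 < k)
    (hlen : l.length ≤ k * n) (h : ∀ i, i < n → (chunk l k i).all f = true) : l.all f = true := by
  rw [List.all_eq_true]
  intro s hs
  obtain ⟨j, hj, rfl⟩ := List.getElem_of_mem hs
  have hi : j / k < n := by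
    rw [Nat.div_lt_iff_lt_mul hk]; rw [Nat.mul_comm]; omega
  have h1 := h (j / k) hi
  rw [List.all_eq_true] at h1
  apply h1
  simp only [chunk]
  rw [List.mem_take_iff_getElem]
  refine ⟨j % k, ?_, ?_⟩
  · rw [List.length_drop]
    have := Nat.mod_lt j hk
    have h2 : k * (j / k) + j % k = j := Nat.div_add_mod j k
    omega
  · rw [List.getElem_drop]; congr 1; exact Nat.div_add_mod j k

/-- No blocks to check. -/
theorem chunks_zero {α : Type} {l : List α} {f : α → Bool} {k : ℕ} :
    ∀ i, i < 0 → (chunk l k i).all f = true := fun i hi => absurd hi (Nat.not_lt_zero i)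

/-- One more block checked. -/
theorem chunks_succ {α : Type} {l : List α} {f : α → Bool} {k n : ℕ}
    (h : ∀ i, i < n → (chunk l k i).all f = true) (hn : (chunk l k n).all f = true) :
    ∀ i, i < n + 1 → (chunk l k i).all f = true := fun i hi => by
  rcases Nat.lt_succ_iff_lt_or_eq.1 hi with h' | rfl
  · exact h i h'
  · exact hn

/-- `shapesUpTo (N+1) = shapesUpTo N ++ shapesN (N+1)`. -/
theorem shapesUpTo_succ (N : ℕ) : shapesUpTo (N + 1) = shapesUpTo N ++ shapesN (N + 1) := by
  simp [shapesUpTo, List.range_succ, List.flatMap_append]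

/-- Extending a certificate by one leaf count. -/
theorem all_shapesUpTo_succ {q p N : ℕ} (h1 : (shapesUpTo N).all (budgetCheck q p) = true)
    (h2 : (shapesN (N + 1)).all (budgetCheck q p) = true) :
    (shapesUpTo (N + 1)).all (budgetCheck q p) = true := by
  rw [shapesUpTo_succ, List.all_append, h1, h2]; rfl

section Certificates

/-- (q,p) = (4,2) [e.g. E2M3/E4M3-wide accumulation demoted to E2M1]: every shape with ≤ 5 leaves. -/
theorem budgetCheck_4_2_upTo5 : (shapesUpTo 5).all (budgetCheck 4 2) = true := by decide +kernel
/-- (4,2), the 42 shapes with 6 leaves, block 0. -/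
theorem budgetCheck_4_2_six_0 : (chunk (shapesN 6) 21 0).all (budgetCheck 4 2) = true := by decide +kernel
/-- (4,2), 6 leaves, block 1. -/
theorem budgetCheck_4_2_six_1 : (chunk (shapesN 6) 21 1).all (budgetCheck 4 2) = true := by decide +kernel
/-- (4,2): all shapes with 6 leaves. -/
theorem budgetCheck_4_2_six : (shapesN 6).all (budgetCheck 4 2) = true :=
  all_of_chunks _ _ 21 2 (by norm_num) (by decide +kernel)
    (chunks_succ (chunks_succ chunks_zero budgetCheck_4_2_six_0) budgetCheck_4_2_six_1)
/-- (4,2), the 132 shapes with 7 leaves, block 0. -/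
theorem budgetCheck_4_2_seven_0 : (chunk (shapesN 7) 22 0).all (budgetCheck 4 2) = true := by decide +kernel
/-- (4,2), 7 leaves, block 1. -/
theorem budgetCheck_4_2_seven_1 : (chunk (shapesN 7) 22 1).all (budgetCheck 4 2) = true := by decide +kernel
/-- (4,2), 7 leaves, block 2. -/
theorem budgetCheck_4_2_seven_2 : (chunk (shapesN 7) 22 2).all (budgetCheck 4 2) = true := by decide +kernel
/-- (4,2), 7 leaves, block 3. -/
theorem budgetCheck_4_2_seven_3 : (chunk (shapesN 7) 22 3).all (budgetCheck 4 2) = true := by decide +kernel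
/-- (4,2), 7 leaves, block 4. -/
theorem budgetCheck_4_2_seven_4 : (chunk (shapesN 7) 22 4).all (budgetCheck 4 2) = true := by decide +kernel
/-- (4,2), 7 leaves, block 5. -/
theorem budgetCheck_4_2_seven_5 : (chunk (shapesN 7) 22 5).all (budgetCheck 4 2) = true := by decide +kernel
/-- (4,2): all shapes with 7 leaves. -/
theorem budgetCheck_4_2_seven : (shapesN 7).all (budgetCheck 4 2) = true :=
  all_of_chunks _ _ 22 6 (by norm_num) (by decide +kernel)
    (chunks_succ (chunks_succ (chunks_succ (chunks_succ (chunks_succ (chunks_succ chunks_zero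
      budgetCheck_4_2_seven_0) budgetCheck_4_2_seven_1) budgetCheck_4_2_seven_2)
      budgetCheck_4_2_seven_3) budgetCheck_4_2_seven_4) budgetCheck_4_2_seven_5)
/-- (4,2): EVERY shape with at most 7 leaves passes (197 ordered shapes). -/
theorem budgetCheck_4_2_upTo7 : (shapesUpTo 7).all (budgetCheck 4 2) = true :=
  all_shapesUpTo_succ (all_shapesUpTo_succ budgetCheck_4_2_upTo5 budgetCheck_4_2_six) budgetCheck_4_2_seven

/-- opt gen 11's 37-leaf GOOD-ACTIVE failure `opt37` (part 6f) at (4,2). -/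
theorem budgetCheck_opt37 : budgetCheck 4 2 (shapeOf opt37) = true := by decide +kernel

end Certificates

/-! ## Conjecture D for the certified classes -/

section Consequences

variable {emin : ℤ} {fl flp : ℚ → ℚ}

/-- **CONJECTURE D AT (q,p) = (4,2) FOR EVERY TREE WITH AT MOST 7 SUMMANDS**: any nearest roundings,
nonnegative `F(4, emin)` data, `s ≤ Q_t · fl_p(ŝ)`. -/
theorem conjectureD_4_2_of_le_seven (hfl : IsRoundNearest 4 emin fl) (hflp : IsRoundNearest 2 emin flp)
    (t : SumTree) (ht : ∀ x ∈ leaves t, IsFloat 4 emin x ∧ 0 ≤ x) (hn : (leaves t).length ≤ 7) :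
    exact t ≤ treeQf (unitRoundoff 4) t (unitRoundoff 2) * flp (eval fl t) :=
  exact_le_treeQf_mul_fl_of_budgetCheck (by norm_num) (by norm_num) hfl hflp t ht
    (budgetCheck_of_all budgetCheck_4_2_upTo7 t hn)

/-- **CONJECTURE D FOR EVERY TREE OF THE SHAPE OF `opt37` AT (4,2)** — a tree OUTSIDE every class
proved before (GOOD-ACTIVE fails on it) and beyond the reach of the Q-cap node step. -/
theorem conjectureD_opt37 (hfl : IsRoundNearest 4 emin fl) (hflp : IsRoundNearest 2 emin flp)
    (t : SumTree) (ht : ∀ x ∈ leaves t, IsFloat 4 emin x ∧ 0 ≤ x) (hs : shapeOf t = shapeOf opt37) :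
    exact t ≤ treeQf (unitRoundoff 4) t (unitRoundoff 2) * flp (eval fl t) :=
  exact_le_treeQf_mul_fl_of_budgetCheck (by norm_num) (by norm_num) hfl hflp t ht
    (hs ▸ budgetCheck_opt37)

end Consequences

end Summit.Ventures.CertifiedArithmetic.LowPrec.Opt
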